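import Literature.Analysis.ValidatedNumerics.IntervalLogArctan
import Literature.Analysis.SpecialFunctions.DigammaStirlingSeries
import Mathlib.NumberTheory.Bernoulli
import Mathlib.Analysis.SpecialFunctions.Trigonometric.Arctan
import HarnessLib

/-!
# Kernel-evaluable enclosures of `ψ(w)` for `Re w > 0` (format C, analysis layer L-C1′: the per-value plumbing)

Topic `Literature/Analysis/ValidatedNumerics`; extends the multi-precision fixed-point interval engine
(`MultiPrecisionInterval.lean`: `MI`/`MC` at scale `S`; `IntervalLogArctan.lean`: `log`, `arctan`, `logUpper`) by

* `MI.piMachin S K` — an enclosure of `π` at any scale (`16·arctan(1/5) − 4·arctan(1/239)`, Machin; Mathlib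
  `Real.four_mul_arctan_inv_5_sub_arctan_inv_239`), so that no caller has to supply `π`;
* `MC.logRight S K piI B` — the principal logarithm of a box in the open RIGHT half-plane (`re = ½ log(re²+im²)`,
  `im = arg = arctan(im/re)`), complementing `MC.logUpper` (upper half-plane);
* `MC.invSum`, `MC.bernSeries` — enclosures of `Σ_{j<J} (w+j)⁻¹` and of `Σ_{k=1}^{ν} c_k · u^k`;
* `MC.digammaBox S K J piI cs W` — an enclosure of `ψ(w)` for `w` in a box `W` with `Re W > 0`, by the SHIFTED STIRLING SERIES
  `ψ(w) = Log(w+J) − Σ_{j<J}(w+j)⁻¹ − 1/(2(w+J)) − Σ_{k=1}^{ν} B_{2k}/(2k (w+J)^{2k}) + R`,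
  `‖R‖ ≤ (π²/3)(2ν+1)!/((2π)^{2ν+1} ‖w+J‖^{2ν} (Re w + J))` (`norm_digamma_sub_stirlingSeries_shift_le`, file
  `DigammaStirlingSeries.lean`), the remainder being absorbed by `widen` with the rational majorant
  `(10/3)(2ν+1)!/(6^{2ν+1} r^{2ν+1})`, `r = Re W_lo + J` (`π² < 10`, `2π > 6`, `‖w+J‖ ≥ Re(w+J)`); the Bernoulli
  numbers enter as a coefficient list `cs` with `cs[k−1] = B_{2k}` (`bernoulliTable`, `B_2 … B_20`, proved);
* inclusion theorems `MI.mem_piMachin`, `MC.mem_logRight`, `MC.mem_invSum`, `MC.mem_bernSeries`, `MC.mem_digammaBox`.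

Use (format C of the Weil-positivity windows, FORMATC-DESIGN §1 (c1)/§6): the Gram entries of the window form need
`Re ψ(¼ + iω/2)`, `Im ψ(¼ + iω/2)` (and `Re ψ′`) at the block's frequencies to `≈ 45` digits inside the kernel; with `S = 2^170`,
`K = 190` series terms, `ν = 10` (`B_2 … B_20`) and `J = 300` the remainder is `< 10⁻⁴⁸` for every `w` with `Re w ≥ ¼`, and the
kernel (`decide +kernel`) certifies e.g. `ψ(1) ∈ −γ ± 10⁻⁴⁵` and box widths `≤ 2⁻¹⁵⁰` at `w = 1` and `w = ¼ + 10i` in `≈ 5 s` per value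
(measured 2026-08-22, farm).  All functions are total and structurally recursive.  Everything here is PROVED.
[cite: Moore1966, Ch. 3–4 (interval extensions)]
-/

open Real Complex Finset

namespace Literature.Analysis.ValidatedNumerics.NumericsMP

variable {S : ℕ} {x y : ℝ} {z w : ℂ}

namespace MI

/-! ### `π` by Machin's formula -/

/-- `π = 16·arctan(1/5) − 4·arctan(1/239)` evaluated with `arctanSmall` (`K` Gregory terms each).
[cite: Moore1966, Ch. 4 (interval evaluation of elementary functions)] -/
def piMachin (S K : ℕ) : Option MI :=
  match arctanSmall S K (ofFrac S 1 5), arctanSmall S K (ofFrac S 1 239) with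
  | some A, some B => some ((A.mulInt 16).sub (B.mulInt 4))
  | _, _ => none

/-- **`piMachin ∋ π`.** [cite: Moore1966, Ch. 4 (interval evaluation of elementary functions)] -/
theorem mem_piMachin (hS : 0 < S) {K : ℕ} {P : MI} (h : piMachin S K = some P) : mem S Real.pi P := by
  unfold piMachin at h
  split at h
  · rename_i A B hA hB
    simp only [Option.some.injEq] at h
    subst h
    have h5 := mem_arctanSmall hS hA (mem_ofFrac S 1 (q := 5) (by norm_num))
    have h239 := mem_arctanSmall hS hB (mem_ofFrac S 1 (q := 239) (by norm_num))
    have e : Real.pi = Real.arctan (((1 : ℤ) : ℝ) / ((5 : ℕ) : ℝ)) * (16 : ℤ)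
        - Real.arctan (((1 : ℤ) : ℝ) / ((239 : ℕ) : ℝ)) * (4 : ℤ) := by
      have hm := Real.four_mul_arctan_inv_5_sub_arctan_inv_239
      push_cast
      rw [one_div, one_div]
      linarith
    rw [e]
    exact mem_sub (mem_mulInt h5 16) (mem_mulInt h239 4)
  · simp at h

end MI

/-! ### The complex logarithm on the right half-plane -/

/-- `arg z = arctan (im z / re z)` for `re z > 0`. [folklore] -/
private theorem arg_eq_arctan_of_re_pos {z : ℂ} (hz : 0 < z.re) :
    Complex.arg z = Real.arctan (z.im / z.re) := by
  rw [Complex.arg_of_re_nonneg hz.le, Real.arctan_eq_arcsin]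
  congr 1
  have hn : ‖z‖ = z.re * Real.sqrt (1 + (z.im / z.re) ^ 2) := by
    have h1 : 0 ≤ z.re * Real.sqrt (1 + (z.im / z.re) ^ 2) := by positivity
    rw [← Real.sqrt_sq (norm_nonneg _), ← Real.sqrt_sq h1]
    congr 1
    rw [mul_pow, Real.sq_sqrt (by positivity), Complex.sq_norm, Complex.normSq_apply]
    field_simp
  rw [hn]
  field_simp

namespace MC

variable {B : MC}

/-- The principal logarithm of a box in the open right half-plane (`none` unless `re > 0` is certified):
`re = ½ log (re² + im²)`, `im = arctan (im/re)`. [cite: Moore1966, Ch. 4 (interval evaluation of elementary functions)] -/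
def logRight (S K : ℕ) (piI : MI) (B : MC) : Option MC :=
  if 0 < B.re.lo then
    match MI.logPos S K (B.normSq S), MI.divPos S B.im B.re with
    | some Lr, some T =>
      match MI.arctan S K piI T with
      | some A => some ⟨Lr.divNat 2, A⟩
      | none => none
    | _, _ => none
  else none

/-- **`logRight ∋ Log z`** (and `re z > 0`). [cite: Moore1966, Ch. 4 (interval evaluation of elementary functions)] -/
theorem mem_logRight (hS : 0 < S) {K : ℕ} {piI : MI} (hpi : MI.mem S Real.pi piI) {Y : MC}
    (h : logRight S K piI B = some Y) (hz : mem S z B) : 0 < z.re ∧ mem S (Complex.log z) Y := by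
  unfold logRight at h
  split_ifs at h with hre
  have hzr : 0 < z.re := MI.pos_of_lo_pos hz.1 hre
  split at h
  · rename_i Lr T hL hT
    split at h
    · rename_i A hA
      simp only [Option.some.injEq] at h
      subst h
      refine ⟨hzr, ?_, ?_⟩
      · -- real part
        obtain ⟨hn0, hlog⟩ := MI.mem_logPos hS hL (mem_normSq hS hz)
        have e : (Complex.log z).re = Real.log (Complex.normSq z) / 2 := by
          rw [Complex.log_re, ← Complex.sq_norm, Real.log_pow]
          push_cast
          ring
        simp only
        rw [e]
        exact MI.mem_divNat hlog (by norm_num)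
      · -- imaginary part
        have hT' := MI.mem_divPos hS hT hz.2 hz.1
        have hA' := MI.mem_arctan hS hpi hA hT'
        have e : (Complex.log z).im = Real.arctan (z.im / z.re) := by
          rw [Complex.log_im, arg_eq_arctan_of_re_pos hzr]
        simp only
        rw [e]
        exact hA'
    · simp at h
  · simp at h

/-! ### `Σ_{j<J} (w+j)⁻¹` -/

/-- Enclosure of `Σ_{j<J} (w + j)⁻¹` (`none` if some `w + j` box is not certified nonzero).
[cite: Moore1966, Ch. 3 (interval arithmetic)] -/
def invSum (S : ℕ) (W : MC) : ℕ → Option MC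
  | 0 => some (ofInt S 0)
  | J + 1 =>
    match invSum S W J, divBox S (ofInt S 1) (W.add (ofInt S (J : ℤ))) with
    | some A, some B => some (A.add B)
    | _, _ => none

/-- **`invSum ∋ Σ_{j<J} (w+j)⁻¹`.** [cite: Moore1966, Ch. 3 (interval arithmetic)] -/
theorem mem_invSum (hS : 0 < S) {W : MC} (hw : mem S w W) :
    ∀ (J : ℕ) {Y : MC}, invSum S W J = some Y → mem S (∑ j ∈ Finset.range J, (w + j)⁻¹) Y
  | 0, Y, h => by
      simp only [invSum, Option.some.injEq] at h
      subst h
      simpa using mem_ofInt S 0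
  | J + 1, Y, h => by
      simp only [invSum] at h
      split at h
      · rename_i A B hA hB
        simp only [Option.some.injEq] at h
        subst h
        rw [Finset.sum_range_succ]
        have hB' := mem_divBox hS hB (mem_ofInt S 1) (mem_add hw (mem_ofInt S (J : ℤ)))
        have e : ((1 : ℤ) : ℂ) / (w + ((J : ℤ) : ℂ)) = (w + (J : ℂ))⁻¹ := by push_cast; rw [one_div]
        rw [e] at hB'
        exact mem_add (mem_invSum hS hw J hA) hB'
      · simp at h

/-! ### `Σ_k c_k u^k` (the Bernoulli part of Stirling's series) -/

/-- State machine for `acc + Σ_i cs[i]/(2(k+i)) · u^{k+i}`: `upow ∋ u^k`, coefficients `cs = [c_k, c_{k+1}, …]`.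
[cite: Moore1966, Ch. 3 (interval arithmetic)] -/
def bernSeries (S : ℕ) (U : MC) : List ℚ → ℕ → MC → MC → MC
  | [], _, _, acc => acc
  | c :: cs, k, upow, acc =>
      bernSeries S U cs (k + 1) (upow.mul S U)
        (acc.add ((upow.mulMI S (MI.ofFrac S c.num c.den)).divNat (2 * k)))

/-- **Invariant of `bernSeries`.** [cite: Moore1966, Ch. 3 (interval arithmetic)] -/
theorem mem_bernSeries (hS : 0 < S) {U : MC} {u : ℂ} (hu : mem S u U) :
    ∀ (cs : List ℚ) (k : ℕ) {upow acc : MC} {a : ℂ}, 0 < k → mem S (u ^ k) upow → mem S a acc →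
      mem S (a + ∑ i ∈ Finset.range cs.length,
        ((cs.getD i 0 : ℚ) : ℂ) / (2 * ((k + i : ℕ) : ℂ)) * u ^ (k + i)) (bernSeries S U cs k upow acc)
  | [], k, upow, acc, a, _, _, ha => by simpa [bernSeries] using ha
  | c :: cs, k, upow, acc, a, hk, hp, ha => by
      rw [bernSeries]
      have hc : MI.mem S ((c.num : ℝ) / (c.den : ℕ)) (MI.ofFrac S c.num c.den) := MI.mem_ofFrac S c.num c.pos
      have hterm := mem_divNat (mem_mulMI hS hp hc) (n := 2 * k) (by omega)
      have hp' : mem S (u ^ (k + 1)) (upow.mul S U) := by rw [pow_succ]; exact mem_mul hS hp hu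
      have ih := mem_bernSeries hS hu cs (k + 1) (by omega) hp' (mem_add ha hterm)
      have ecast : (((c.num : ℝ) / (c.den : ℕ) : ℝ) : ℂ) = ((c : ℚ) : ℂ) := by
        rw [← Complex.ofReal_ratCast]
        congr 1
        exact_mod_cast (Rat.num_div_den c)
      rw [ecast] at ih
      have e : a + ∑ i ∈ Finset.range (c :: cs).length,
            (((c :: cs).getD i 0 : ℚ) : ℂ) / (2 * ((k + i : ℕ) : ℂ)) * u ^ (k + i) =
          (a + u ^ k * ((c : ℚ) : ℂ) / ((2 * k : ℕ) : ℂ)) + ∑ i ∈ Finset.range cs.length,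
            ((cs.getD i 0 : ℚ) : ℂ) / (2 * ((k + 1 + i : ℕ) : ℂ)) * u ^ (k + 1 + i) := by
        rw [List.length_cons, Finset.sum_range_succ']
        simp only [List.getD_cons_succ, List.getD_cons_zero, add_zero]
        have hterm : ∀ i ∈ Finset.range cs.length,
            ((cs.getD i 0 : ℚ) : ℂ) / (2 * ((k + (i + 1) : ℕ) : ℂ)) * u ^ (k + (i + 1)) =
              ((cs.getD i 0 : ℚ) : ℂ) / (2 * ((k + 1 + i : ℕ) : ℂ)) * u ^ (k + 1 + i) := fun i _ ↦ by
          rw [show k + (i + 1) = k + 1 + i by omega]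
        rw [Finset.sum_congr rfl hterm]
        push_cast
        ring
      rw [e]
      exact ih

/-! ### The Bernoulli numbers `B₂ … B₂₀` -/

/-- `[B₂, B₄, …, B₂₀]`. [cite: AbramowitzStegun1964, Table 23.2] -/
def bernoulliTable : List ℚ :=
  [1 / 6, -1 / 30, 1 / 42, -1 / 30, 5 / 66, -691 / 2730, 7 / 6, -3617 / 510, 43867 / 798, -174611 / 330]

/-- `B'_5`. [cite: AbramowitzStegun1964, Table 23.2] -/
private theorem b5 : bernoulli' 5 = 0 := bernoulli'_eq_zero_of_odd (by decide) (by norm_num)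
/-- `B'_7`. [cite: AbramowitzStegun1964, Table 23.2] -/
private theorem b7 : bernoulli' 7 = 0 := bernoulli'_eq_zero_of_odd (by decide) (by norm_num)
/-- `B'_9`. [cite: AbramowitzStegun1964, Table 23.2] -/
private theorem b9 : bernoulli' 9 = 0 := bernoulli'_eq_zero_of_odd (by decide) (by norm_num)
/-- `B'_11`. [cite: AbramowitzStegun1964, Table 23.2] -/
private theorem b11 : bernoulli' 11 = 0 := bernoulli'_eq_zero_of_odd (by decide) (by norm_num)
/-- `B'_13`. [cite: AbramowitzStegun1964, Table 23.2] -/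
private theorem b13 : bernoulli' 13 = 0 := bernoulli'_eq_zero_of_odd (by decide) (by norm_num)
/-- `B'_15`. [cite: AbramowitzStegun1964, Table 23.2] -/
private theorem b15 : bernoulli' 15 = 0 := bernoulli'_eq_zero_of_odd (by decide) (by norm_num)
/-- `B'_17`. [cite: AbramowitzStegun1964, Table 23.2] -/
private theorem b17 : bernoulli' 17 = 0 := bernoulli'_eq_zero_of_odd (by decide) (by norm_num)
/-- `B'_19`. [cite: AbramowitzStegun1964, Table 23.2] -/
private theorem b19 : bernoulli' 19 = 0 := bernoulli'_eq_zero_of_odd (by decide) (by norm_num)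

/-- `B'_6`. [cite: AbramowitzStegun1964, Table 23.2] -/
private theorem b6 : bernoulli' 6 = 1 / 42 := by
  rw [bernoulli'_def]
  norm_num [Finset.sum_range_succ, Nat.choose, bernoulli'_zero, bernoulli'_one, bernoulli'_two, bernoulli'_three,
    bernoulli'_four, b5]

/-- `B'_8`. [cite: AbramowitzStegun1964, Table 23.2] -/
private theorem b8 : bernoulli' 8 = -1 / 30 := by
  rw [bernoulli'_def]
  norm_num [Finset.sum_range_succ, Nat.choose, bernoulli'_zero, bernoulli'_one, bernoulli'_two, bernoulli'_three,
    bernoulli'_four, b5, b6, b7]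

/-- `B'_10`. [cite: AbramowitzStegun1964, Table 23.2] -/
private theorem b10 : bernoulli' 10 = 5 / 66 := by
  rw [bernoulli'_def]
  norm_num [Finset.sum_range_succ, Nat.choose, bernoulli'_zero, bernoulli'_one, bernoulli'_two, bernoulli'_three,
    bernoulli'_four, b5, b6, b7, b8, b9]

/-- `B'_12`. [cite: AbramowitzStegun1964, Table 23.2] -/
private theorem b12 : bernoulli' 12 = -691 / 2730 := by
  rw [bernoulli'_def]
  norm_num [Finset.sum_range_succ, Nat.choose, bernoulli'_zero, bernoulli'_one, bernoulli'_two, bernoulli'_three,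
    bernoulli'_four, b5, b6, b7, b8, b9, b10, b11]

/-- `B'_14`. [cite: AbramowitzStegun1964, Table 23.2] -/
private theorem b14 : bernoulli' 14 = 7 / 6 := by
  rw [bernoulli'_def]
  norm_num [Finset.sum_range_succ, Nat.choose, bernoulli'_zero, bernoulli'_one, bernoulli'_two, bernoulli'_three,
    bernoulli'_four, b5, b6, b7, b8, b9, b10, b11, b12, b13]

/-- `B'_16`. [cite: AbramowitzStegun1964, Table 23.2] -/
private theorem b16 : bernoulli' 16 = -3617 / 510 := by
  rw [bernoulli'_def]
  norm_num [Finset.sum_range_succ, Nat.choose, bernoulli'_zero, bernoulli'_one, bernoulli'_two, bernoulli'_three,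
    bernoulli'_four, b5, b6, b7, b8, b9, b10, b11, b12, b13, b14, b15]

/-- `B'_18`. [cite: AbramowitzStegun1964, Table 23.2] -/
private theorem b18 : bernoulli' 18 = 43867 / 798 := by
  rw [bernoulli'_def]
  norm_num [Finset.sum_range_succ, Nat.choose, bernoulli'_zero, bernoulli'_one, bernoulli'_two, bernoulli'_three,
    bernoulli'_four, b5, b6, b7, b8, b9, b10, b11, b12, b13, b14, b15, b16, b17]

/-- `B'_20`. [cite: AbramowitzStegun1964, Table 23.2] -/
private theorem b20 : bernoulli' 20 = -174611 / 330 := by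
  rw [bernoulli'_def]
  norm_num [Finset.sum_range_succ, Nat.choose, bernoulli'_zero, bernoulli'_one, bernoulli'_two, bernoulli'_three,
    bernoulli'_four, b5, b6, b7, b8, b9, b10, b11, b12, b13, b14, b15, b16, b17, b18, b19]

/-- **The table is correct**: `bernoulliTable[k] = B_{2(k+1)}` for `k < 10`. [cite: AbramowitzStegun1964, Table 23.2] -/
theorem bernoulliTable_getD {k : ℕ} (hk : k < 10) : bernoulliTable.getD k 0 = bernoulli (2 * (k + 1)) := by
  rw [bernoulli_eq_bernoulli'_of_ne_one (by omega)]
  interval_cases k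
  · simp [bernoulliTable, bernoulli'_two]
  · simp [bernoulliTable, bernoulli'_four]
  · simp [bernoulliTable, b6]
  · simp [bernoulliTable, b8]
  · simp [bernoulliTable, b10]
  · simp [bernoulliTable, b12]
  · simp [bernoulliTable, b14]
  · simp [bernoulliTable, b16]
  · simp [bernoulliTable, b18]
  · simp [bernoulliTable, b20]

/-- `bernoulliTable` has length `10`. [folklore] -/
private theorem bernoulliTable_length : bernoulliTable.length = 10 := rfl

/-! ### `ψ(w)` by the shifted Stirling series -/

/-- Outward scaled majorant `⌈S · (10/3)(2ν+1)! / (6^{2ν+1} r^{2ν+1})⌉`, `r = relo/S + J`, of the Stirling remainder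
`(π²/3)(2ν+1)!/((2π)^{2ν+1}‖w+J‖^{2ν}(Re w + J))` when `Re w ≥ relo/S > 0`. [folklore] -/
def stirlingRemScaled (S ν : ℕ) (relo : ℤ) (J : ℕ) : ℤ :=
  ⌈(S : ℚ) * ((10 / 3 : ℚ) * ((2 * ν + 1).factorial : ℚ) /
      ((6 : ℚ) ^ (2 * ν + 1) * ((relo : ℚ) / S + J) ^ (2 * ν + 1)))⌉

/-- **Enclosure of `ψ(w)`** on a box `W` with certified `Re W > 0`: shifted Stirling series with `J` shift terms and the
Bernoulli coefficients `cs = [B₂, B₄, …, B_{2ν}]` (e.g. `bernoulliTable`), widened by `stirlingRemScaled`; `none` if a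
division box is not certified. [cite: AndrewsAskeyRoy1999, Thm 1.2.5 and Cor 1.4.5] -/
def digammaBox (S K J : ℕ) (piI : MI) (cs : List ℚ) (W : MC) : Option MC :=
  if 0 < W.re.lo then
    match logRight S K piI (W.add (ofInt S (J : ℤ))), divBox S (ofInt S 1) (W.add (ofInt S (J : ℤ))),
        invSum S W J with
    | some L, some I, some T =>
        some ((((L.sub T).sub (I.divNat 2)).sub (bernSeries S (I.sqr S) cs 1 (I.sqr S) (ofInt S 0))).widen
          (stirlingRemScaled S cs.length W.re.lo J))
    | _, _, _ => none
  else none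

/-- **`digammaBox ∋ ψ(w)`**: for `w ∈ W` (so `Re w > 0`), `π ∈ piI` and a coefficient list with `cs[k] = B_{2(k+1)}`,
the box `digammaBox S K J piI cs W` contains `ψ(w)`. [cite: AndrewsAskeyRoy1999, Thm 1.2.5 and Cor 1.4.5] -/
theorem mem_digammaBox (hS : 0 < S) {K J : ℕ} {piI : MI} (hpi : MI.mem S Real.pi piI) {cs : List ℚ}
    (hcs0 : cs ≠ []) (hcs : ∀ k < cs.length, ((cs.getD k 0 : ℚ) : ℂ) = (bernoulli (2 * (k + 1)) : ℂ))
    {W Y : MC} (h : digammaBox S K J piI cs W = some Y) (hw : mem S w W) :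
    mem S (Complex.digamma w) Y := by
  unfold digammaBox at h
  split_ifs at h with hre
  split at h
  · rename_i L I T hL hI hT
    simp only [Option.some.injEq] at h
    subst h
    have hSr : (0 : ℝ) < S := by exact_mod_cast hS
    have hwre : 0 < w.re := MI.pos_of_lo_pos hw.1 hre
    have hWJ : mem S (w + (J : ℂ)) (W.add (ofInt S (J : ℤ))) := by
      have := mem_add hw (mem_ofInt S (J : ℤ)); push_cast at this; exact this
    have hL' := (mem_logRight hS hpi hL hWJ).2
    have hI' : mem S ((w + J)⁻¹) I := by
      have := mem_divBox hS hI (mem_ofInt S 1) hWJ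
      push_cast at this
      rwa [one_div] at this
    have hT' := mem_invSum hS hw J hT
    have hU : mem S (((w + J)⁻¹) ^ 2) (I.sqr S) := mem_sqr hS hI'
    have hB := mem_bernSeries hS hU cs 1 one_pos (by rw [pow_one]; exact hU) (mem_ofInt S 0)
    have hmain := mem_sub (mem_sub (mem_sub hL' hT') (mem_divNat hI' (n := 2) two_pos)) hB
    -- the main term of the shifted Stirling series
    set ν := cs.length with hν
    have hν0 : ν ≠ 0 := fun h0 ↦ hcs0 (List.eq_nil_of_length_eq_zero h0)
    have ebern : (((0 : ℤ) : ℂ) + ∑ i ∈ Finset.range ν,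
          ((cs.getD i 0 : ℚ) : ℂ) / (2 * ((1 + i : ℕ) : ℂ)) * (((w + J)⁻¹) ^ 2) ^ (1 + i)) =
        ∑ k ∈ Finset.Icc 1 ν, (bernoulli (2 * k) : ℂ) / (2 * k) / (w + J) ^ (2 * k) := by
      rw [Int.cast_zero, zero_add, ← Finset.Ico_add_one_right_eq_Icc, Finset.sum_Ico_eq_sum_range,
        show ν + 1 - 1 = ν by omega]
      refine Finset.sum_congr rfl fun i hi ↦ ?_
      rw [Finset.mem_range] at hi
      have hc := hcs i hi
      rw [show 1 + i = i + 1 by ring] at *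
      rw [hc, ← pow_mul, inv_pow]
      push_cast
      ring
    have hmain' : mem S (Complex.log (w + J) - ∑ j ∈ Finset.range J, (w + j)⁻¹ - 1 / (2 * (w + J)) -
        ∑ k ∈ Finset.Icc 1 ν, (bernoulli (2 * k) : ℂ) / (2 * k) / (w + J) ^ (2 * k))
        (((L.sub T).sub (I.divNat 2)).sub (bernSeries S (I.sqr S) cs 1 (I.sqr S) (ofInt S 0))) := by
      convert hmain using 2
      · push_cast
        rw [one_div, mul_inv]
        ring
      · exact ebern.symm
    -- the remainder
    have hrem := Literature.Analysis.SpecialFunctions.Complex.norm_digamma_sub_stirlingSeries_shift_le hwre J hν0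
    apply mem_widen hmain'
    -- ‖ψ w − Mthm‖ · S ≤ stirlingRemScaled
    set r : ℝ := (W.re.lo : ℝ) / S + J with hr
    have hrpos : 0 < r := by
      have : (0 : ℝ) < W.re.lo := by exact_mod_cast hre
      rw [hr]; positivity
    have hr_le : r ≤ w.re + J := by
      have h1 : (W.re.lo : ℝ) / S ≤ w.re := by rw [div_le_iff₀ hSr]; exact hw.1.1
      rw [hr]; linarith
    have hnorm : w.re + J ≤ ‖w + (J : ℂ)‖ := by
      have := Complex.abs_re_le_norm (w + (J : ℂ))
      simp only [Complex.add_re, Complex.natCast_re] at this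
      exact le_trans (le_abs_self _) this
    have hden : r ^ (2 * ν + 1) ≤ ‖w + (J : ℂ)‖ ^ (2 * ν) * (w.re + J) := by
      rw [pow_succ]
      exact mul_le_mul (pow_le_pow_left₀ hrpos.le (hr_le.trans hnorm) _) hr_le hrpos.le (by positivity)
    have hpi10 : Real.pi ^ 2 ≤ 10 := by nlinarith [Real.pi_pos, Real.pi_lt_d2]
    have hsix : (6 : ℝ) ≤ 2 * Real.pi := by linarith [Real.pi_gt_three]
    have hF : (0 : ℝ) < ((2 * ν + 1).factorial : ℝ) := by positivity
    have hrp : 0 < r ^ (2 * ν + 1) := by positivity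
    have h6p : (0 : ℝ) < (6 : ℝ) ^ (2 * ν + 1) := by positivity
    have hpow : (6 : ℝ) ^ (2 * ν + 1) ≤ (2 * Real.pi) ^ (2 * ν + 1) := pow_le_pow_left₀ (by norm_num) hsix _
    -- A/B ≤ A'/B' with A ≤ A', 0 < B' ≤ B
    have hA : Real.pi ^ 2 / 3 * ((2 * ν + 1).factorial : ℝ) / (2 * Real.pi) ^ (2 * ν + 1)
        ≤ 10 / 3 * ((2 * ν + 1).factorial : ℝ) / (6 : ℝ) ^ (2 * ν + 1) := by
      rw [div_le_div_iff₀ (by positivity) h6p]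
      calc Real.pi ^ 2 / 3 * ((2 * ν + 1).factorial : ℝ) * (6 : ℝ) ^ (2 * ν + 1)
          ≤ 10 / 3 * ((2 * ν + 1).factorial : ℝ) * (6 : ℝ) ^ (2 * ν + 1) := by
            apply mul_le_mul_of_nonneg_right _ h6p.le
            exact mul_le_mul_of_nonneg_right (by linarith) hF.le
        _ ≤ 10 / 3 * ((2 * ν + 1).factorial : ℝ) * (2 * Real.pi) ^ (2 * ν + 1) :=
            mul_le_mul_of_nonneg_left hpow (by positivity)
    have hR : Real.pi ^ 2 / 3 * ((2 * ν + 1).factorial : ℝ) / (2 * Real.pi) ^ (2 * ν + 1) /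
          (‖w + (J : ℂ)‖ ^ (2 * ν) * (w.re + J))
        ≤ 10 / 3 * ((2 * ν + 1).factorial : ℝ) / (6 : ℝ) ^ (2 * ν + 1) / r ^ (2 * ν + 1) := by
      rw [div_le_div_iff₀ (lt_of_lt_of_le hrp hden) hrp]
      calc Real.pi ^ 2 / 3 * ((2 * ν + 1).factorial : ℝ) / (2 * Real.pi) ^ (2 * ν + 1) * r ^ (2 * ν + 1)
          ≤ 10 / 3 * ((2 * ν + 1).factorial : ℝ) / (6 : ℝ) ^ (2 * ν + 1) * r ^ (2 * ν + 1) :=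
            mul_le_mul_of_nonneg_right hA hrp.le
        _ ≤ 10 / 3 * ((2 * ν + 1).factorial : ℝ) / (6 : ℝ) ^ (2 * ν + 1) * (‖w + (J : ℂ)‖ ^ (2 * ν) * (w.re + J)) :=
            mul_le_mul_of_nonneg_left hden (by positivity)
    have hceil : (S : ℝ) * (10 / 3 * ((2 * ν + 1).factorial : ℝ) / (6 : ℝ) ^ (2 * ν + 1) / r ^ (2 * ν + 1))
        ≤ (stirlingRemScaled S ν W.re.lo J : ℝ) := by
      have hq := Int.le_ceil ((S : ℚ) * ((10 / 3 : ℚ) * ((2 * ν + 1).factorial : ℚ) /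
        ((6 : ℚ) ^ (2 * ν + 1) * ((W.re.lo : ℚ) / S + J) ^ (2 * ν + 1))))
      have hq' := (Rat.cast_le (K := ℝ)).2 hq
      unfold stirlingRemScaled
      rw [Rat.cast_intCast] at hq'
      refine le_trans (le_of_eq ?_) hq'
      rw [hr, div_div]
      push_cast
      ring
    calc ‖Complex.digamma w - (Complex.log (w + J) - ∑ j ∈ Finset.range J, (w + j)⁻¹ - 1 / (2 * (w + J)) -
          ∑ k ∈ Finset.Icc 1 ν, (bernoulli (2 * k) : ℂ) / (2 * k) / (w + J) ^ (2 * k))‖ * S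
        ≤ Real.pi ^ 2 / 3 * ((2 * ν + 1).factorial : ℝ) / (2 * Real.pi) ^ (2 * ν + 1) /
            (‖w + (J : ℂ)‖ ^ (2 * ν) * (w.re + J)) * S := mul_le_mul_of_nonneg_right hrem hSr.le
      _ ≤ 10 / 3 * ((2 * ν + 1).factorial : ℝ) / (6 : ℝ) ^ (2 * ν + 1) / r ^ (2 * ν + 1) * S :=
          mul_le_mul_of_nonneg_right hR hSr.le
      _ = (S : ℝ) * (10 / 3 * ((2 * ν + 1).factorial : ℝ) / (6 : ℝ) ^ (2 * ν + 1) / r ^ (2 * ν + 1)) := by ring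
      _ ≤ (stirlingRemScaled S ν W.re.lo J : ℝ) := hceil
  · simp at h

/-- **`ψ(w)` with the proved Bernoulli table** (`ν = 10`): the caller supplies only `S, K, J`, a `π` box and `W`.
[cite: AndrewsAskeyRoy1999, Thm 1.2.5 and Cor 1.4.5] -/
theorem mem_digammaBox_table (hS : 0 < S) {K J : ℕ} {piI : MI} (hpi : MI.mem S Real.pi piI) {W Y : MC}
    (h : digammaBox S K J piI bernoulliTable W = some Y) (hw : mem S w W) : mem S (Complex.digamma w) Y :=
  mem_digammaBox hS hpi (by simp [bernoulliTable]) (fun k hk ↦ by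
    rw [bernoulliTable_length] at hk
    exact_mod_cast bernoulliTable_getD hk) h hw

end MC

end Literature.Analysis.ValidatedNumerics.NumericsMP

/-! ## Appendix (append-only, 2026-08-22): `ψ′` -/

namespace Literature.Analysis.ValidatedNumerics.NumericsMP

variable {S : ℕ} {w : ℂ}

namespace MC

/-! ### `ψ′(w)` by the shifted Stirling series (appended 2026-08-22, weil-2 gen2) -/

/-- Enclosure of `Σ_{j<J} ((w + j)²)⁻¹`. [cite: Moore1966, Ch. 3 (interval arithmetic)] -/
def invSqSum (S : ℕ) (W : MC) : ℕ → Option MC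
  | 0 => some (ofInt S 0)
  | J + 1 =>
    match invSqSum S W J, divBox S (ofInt S 1) ((W.add (ofInt S (J : ℤ))).sqr S) with
    | some A, some B => some (A.add B)
    | _, _ => none

/-- **`invSqSum ∋ Σ_{j<J} ((w+j)²)⁻¹`.** [cite: Moore1966, Ch. 3 (interval arithmetic)] -/
theorem mem_invSqSum (hS : 0 < S) {W : MC} (hw : mem S w W) :
    ∀ (J : ℕ) {Y : MC}, invSqSum S W J = some Y → mem S (∑ j ∈ Finset.range J, ((w + j) ^ 2)⁻¹) Y
  | 0, Y, h => by
      simp only [invSqSum, Option.some.injEq] at h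
      subst h
      simpa using mem_ofInt S 0
  | J + 1, Y, h => by
      simp only [invSqSum] at h
      split at h
      · rename_i A B hA hB
        simp only [Option.some.injEq] at h
        subst h
        rw [Finset.sum_range_succ]
        have hB' := mem_divBox hS hB (mem_ofInt S 1) (mem_sqr hS (mem_add hw (mem_ofInt S (J : ℤ))))
        have e : ((1 : ℤ) : ℂ) / (w + ((J : ℤ) : ℂ)) ^ 2 = ((w + (J : ℂ)) ^ 2)⁻¹ := by push_cast; rw [one_div]
        rw [e] at hB'
        exact mem_add (mem_invSqSum hS hw J hA) hB'
      · simp at h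

/-- `[2·1·B₂, 2·2·B₄, …]`: the coefficient list that turns `bernSeries` (which divides by `2k`) into `Σ B_{2k} u^k`.
[folklore] -/
def twoKTimes : ℕ → List ℚ → List ℚ
  | _, [] => []
  | k, c :: cs => (2 * k : ℚ) * c :: twoKTimes (k + 1) cs

/-- `twoKTimes` preserves the length. [folklore] -/
private theorem length_twoKTimes : ∀ (k : ℕ) (cs : List ℚ), (twoKTimes k cs).length = cs.length
  | _, [] => rfl
  | k, c :: cs => by simp [twoKTimes, length_twoKTimes (k + 1) cs]

/-- Entries of `twoKTimes`. [folklore] -/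
private theorem getD_twoKTimes : ∀ (k : ℕ) (cs : List ℚ) (i : ℕ), i < cs.length →
    (twoKTimes k cs).getD i 0 = (2 * (k + i) : ℚ) * cs.getD i 0
  | _, [], i, h => by simp at h
  | k, c :: cs, 0, _ => by simp [twoKTimes]
  | k, c :: cs, i + 1, h => by
      simp only [twoKTimes, List.getD_cons_succ]
      rw [getD_twoKTimes (k + 1) cs i (by simpa using h)]
      push_cast
      ring

/-- Outward scaled majorant of the `ψ′` Stirling remainder: `⌈S·(2ν+2)(10/3)(2ν+1)!/(6^{2ν+1} r^{2ν+2})⌉`, `r = relo/S + J`.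
[folklore] -/
def stirlingRemDerivScaled (S ν : ℕ) (relo : ℤ) (J : ℕ) : ℤ :=
  ⌈(S : ℚ) * ((2 * ν + 2 : ℚ) * ((10 / 3 : ℚ) * ((2 * ν + 1).factorial : ℚ)) /
      ((6 : ℚ) ^ (2 * ν + 1) * ((relo : ℚ) / S + J) ^ (2 * ν + 2)))⌉

/-- **Enclosure of `ψ′(w)`** on a box `W` with certified `Re W > 0`:
`ψ′(w) ≈ Σ_{j<J}((w+j)²)⁻¹ + (w+J)⁻¹ + ½(w+J)⁻² + (w+J)⁻¹·Σ_k B_{2k} (w+J)^{−2k}`, widened by `stirlingRemDerivScaled`.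
[cite: AndrewsAskeyRoy1999, (1.2.14) and Cor 1.4.5] -/
def trigammaBox (S J : ℕ) (cs : List ℚ) (W : MC) : Option MC :=
  if 0 < W.re.lo then
    match divBox S (ofInt S 1) (W.add (ofInt S (J : ℤ))), invSqSum S W J with
    | some I, some T =>
        some ((((T.add I).add ((I.sqr S).divNat 2)).add
          ((bernSeries S (I.sqr S) (twoKTimes 1 cs) 1 (I.sqr S) (ofInt S 0)).mul S I)).widen
          (stirlingRemDerivScaled S cs.length W.re.lo J))
    | _, _ => none
  else none

/-- **`trigammaBox ∋ ψ′(w)`** for `w ∈ W` (`Re W > 0` certified) and `cs[k] = B_{2(k+1)}`.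
[cite: AndrewsAskeyRoy1999, (1.2.14) and Cor 1.4.5] -/
theorem mem_trigammaBox (hS : 0 < S) {J : ℕ} {cs : List ℚ}
    (hcs0 : cs ≠ []) (hcs : ∀ k < cs.length, ((cs.getD k 0 : ℚ) : ℂ) = (bernoulli (2 * (k + 1)) : ℂ))
    {W Y : MC} (h : trigammaBox S J cs W = some Y) (hw : mem S w W) :
    mem S (deriv Complex.digamma w) Y := by
  unfold trigammaBox at h
  split_ifs at h with hre
  split at h
  · rename_i I T hI hT
    simp only [Option.some.injEq] at h
    subst h
    have hSr : (0 : ℝ) < S := by exact_mod_cast hS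
    have hwre : 0 < w.re := MI.pos_of_lo_pos hw.1 hre
    have hWJ : mem S (w + (J : ℂ)) (W.add (ofInt S (J : ℤ))) := by
      have := mem_add hw (mem_ofInt S (J : ℤ)); push_cast at this; exact this
    have hI' : mem S ((w + J)⁻¹) I := by
      have := mem_divBox hS hI (mem_ofInt S 1) hWJ
      push_cast at this
      rwa [one_div] at this
    have hT' := mem_invSqSum hS hw J hT
    have hU : mem S (((w + J)⁻¹) ^ 2) (I.sqr S) := mem_sqr hS hI'
    have hB := mem_bernSeries hS hU (twoKTimes 1 cs) 1 one_pos (by rw [pow_one]; exact hU) (mem_ofInt S 0)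
    have hmain := mem_add (mem_add (mem_add hT' hI') (mem_divNat hU (n := 2) two_pos)) (mem_mul hS hB hI')
    set ν := cs.length with hν
    have hν0 : ν ≠ 0 := fun h0 ↦ hcs0 (List.eq_nil_of_length_eq_zero h0)
    have hlen : (twoKTimes 1 cs).length = ν := by rw [length_twoKTimes]
    have ebern : ((((0 : ℤ) : ℂ) + ∑ i ∈ Finset.range (twoKTimes 1 cs).length,
          (((twoKTimes 1 cs).getD i 0 : ℚ) : ℂ) / (2 * ((1 + i : ℕ) : ℂ)) * (((w + J)⁻¹) ^ 2) ^ (1 + i)) * (w + J)⁻¹) =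
        ∑ k ∈ Finset.Icc 1 ν, (bernoulli (2 * k) : ℂ) / (w + J) ^ (2 * k + 1) := by
      rw [hlen, Int.cast_zero, zero_add, ← Finset.Ico_add_one_right_eq_Icc, Finset.sum_Ico_eq_sum_range,
        show ν + 1 - 1 = ν by omega, Finset.sum_mul]
      refine Finset.sum_congr rfl fun i hi ↦ ?_
      rw [Finset.mem_range] at hi
      have hc := hcs i hi
      rw [getD_twoKTimes 1 cs i hi]
      rw [show 1 + i = i + 1 by ring] at *
      push_cast
      rw [hc, ← pow_mul, inv_pow]
      have h2 : ((i : ℂ) + 1) ≠ 0 := by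
        have : (0 : ℝ) < (i : ℝ) + 1 := by positivity
        exact_mod_cast this.ne'
      have hwJ : (w + (J : ℂ)) ≠ 0 := by
        intro h0; have := congrArg Complex.re h0; simp at this; linarith [Nat.cast_nonneg (α := ℝ) J]
      field_simp
      ring
    have hmain' : mem S (∑ j ∈ Finset.range J, ((w + j) ^ 2)⁻¹ + 1 / (w + J) + 1 / (2 * (w + J) ^ 2) +
        ∑ k ∈ Finset.Icc 1 ν, (bernoulli (2 * k) : ℂ) / (w + J) ^ (2 * k + 1))
        ((((T.add I).add ((I.sqr S).divNat 2)).add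
          ((bernSeries S (I.sqr S) (twoKTimes 1 cs) 1 (I.sqr S) (ofInt S 0)).mul S I))) := by
      convert hmain using 2
      · push_cast
        rw [one_div, one_div, mul_inv, inv_pow]
        ring
      · exact ebern.symm
    -- the remainder
    have hrem := Literature.Analysis.SpecialFunctions.Complex.norm_deriv_digamma_sub_stirlingSeries_shift_le hwre J hν0
    apply mem_widen hmain'
    set r : ℝ := (W.re.lo : ℝ) / S + J with hr
    have hrpos : 0 < r := by
      have : (0 : ℝ) < W.re.lo := by exact_mod_cast hre
      rw [hr]; positivity
    have hr_le : r ≤ w.re + J := by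
      have h1 : (W.re.lo : ℝ) / S ≤ w.re := by rw [div_le_iff₀ hSr]; exact hw.1.1
      rw [hr]; linarith
    have hnorm : w.re + J ≤ ‖w + (J : ℂ)‖ := by
      have := Complex.abs_re_le_norm (w + (J : ℂ))
      simp only [Complex.add_re, Complex.natCast_re] at this
      exact le_trans (le_abs_self _) this
    have hden : r ^ (2 * ν + 2) ≤ ‖w + (J : ℂ)‖ ^ (2 * ν + 1) * (w.re + J) := by
      rw [pow_succ]
      exact mul_le_mul (pow_le_pow_left₀ hrpos.le (hr_le.trans hnorm) _) hr_le hrpos.le (by positivity)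
    have hpi10 : Real.pi ^ 2 ≤ 10 := by nlinarith [Real.pi_pos, Real.pi_lt_d2]
    have hsix : (6 : ℝ) ≤ 2 * Real.pi := by linarith [Real.pi_gt_three]
    have hF : (0 : ℝ) < ((2 * ν + 1).factorial : ℝ) := by positivity
    have hrp : 0 < r ^ (2 * ν + 2) := by positivity
    have h6p : (0 : ℝ) < (6 : ℝ) ^ (2 * ν + 1) := by positivity
    have hpow : (6 : ℝ) ^ (2 * ν + 1) ≤ (2 * Real.pi) ^ (2 * ν + 1) := pow_le_pow_left₀ (by norm_num) hsix _
    have hν2 : (0 : ℝ) < 2 * ν + 2 := by positivity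
    have hA : (2 * ν + 2) * (Real.pi ^ 2 / 3 * ((2 * ν + 1).factorial : ℝ) / (2 * Real.pi) ^ (2 * ν + 1))
        ≤ (2 * ν + 2) * ((10 / 3) * ((2 * ν + 1).factorial : ℝ)) / (6 : ℝ) ^ (2 * ν + 1) := by
      have e1 : (2 * ν + 2) * (Real.pi ^ 2 / 3 * ((2 * ν + 1).factorial : ℝ) / (2 * Real.pi) ^ (2 * ν + 1))
          = (2 * ν + 2) * (Real.pi ^ 2 / 3 * ((2 * ν + 1).factorial : ℝ)) / (2 * Real.pi) ^ (2 * ν + 1) := by ring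
      rw [e1, div_le_div_iff₀ (by positivity) h6p]
      calc (2 * ν + 2) * (Real.pi ^ 2 / 3 * ((2 * ν + 1).factorial : ℝ)) * (6 : ℝ) ^ (2 * ν + 1)
          ≤ (2 * ν + 2) * (10 / 3 * ((2 * ν + 1).factorial : ℝ)) * (6 : ℝ) ^ (2 * ν + 1) := by
            apply mul_le_mul_of_nonneg_right _ h6p.le
            apply mul_le_mul_of_nonneg_left _ hν2.le
            exact mul_le_mul_of_nonneg_right (by linarith) hF.le
        _ ≤ (2 * ν + 2) * (10 / 3 * ((2 * ν + 1).factorial : ℝ)) * (2 * Real.pi) ^ (2 * ν + 1) :=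
            mul_le_mul_of_nonneg_left hpow (by positivity)
    have hR : (2 * ν + 2) * (Real.pi ^ 2 / 3 * ((2 * ν + 1).factorial : ℝ) / (2 * Real.pi) ^ (2 * ν + 1)) /
          (‖w + (J : ℂ)‖ ^ (2 * ν + 1) * (w.re + J))
        ≤ (2 * ν + 2) * ((10 / 3) * ((2 * ν + 1).factorial : ℝ)) / (6 : ℝ) ^ (2 * ν + 1) / r ^ (2 * ν + 2) := by
      rw [div_le_div_iff₀ (lt_of_lt_of_le hrp hden) hrp]
      calc (2 * ν + 2) * (Real.pi ^ 2 / 3 * ((2 * ν + 1).factorial : ℝ) / (2 * Real.pi) ^ (2 * ν + 1)) * r ^ (2 * ν + 2)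
          ≤ (2 * ν + 2) * ((10 / 3) * ((2 * ν + 1).factorial : ℝ)) / (6 : ℝ) ^ (2 * ν + 1) * r ^ (2 * ν + 2) :=
            mul_le_mul_of_nonneg_right hA hrp.le
        _ ≤ (2 * ν + 2) * ((10 / 3) * ((2 * ν + 1).factorial : ℝ)) / (6 : ℝ) ^ (2 * ν + 1) *
              (‖w + (J : ℂ)‖ ^ (2 * ν + 1) * (w.re + J)) :=
            mul_le_mul_of_nonneg_left hden (by positivity)
    have hceil : (S : ℝ) * ((2 * ν + 2) * ((10 / 3) * ((2 * ν + 1).factorial : ℝ)) / (6 : ℝ) ^ (2 * ν + 1) / r ^ (2 * ν + 2))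
        ≤ (stirlingRemDerivScaled S ν W.re.lo J : ℝ) := by
      have hq := Int.le_ceil ((S : ℚ) * ((2 * ν + 2 : ℚ) * ((10 / 3 : ℚ) * ((2 * ν + 1).factorial : ℚ)) /
        ((6 : ℚ) ^ (2 * ν + 1) * ((W.re.lo : ℚ) / S + J) ^ (2 * ν + 2))))
      have hq' := (Rat.cast_le (K := ℝ)).2 hq
      unfold stirlingRemDerivScaled
      rw [Rat.cast_intCast] at hq'
      refine le_trans (le_of_eq ?_) hq'
      rw [hr, div_div]
      push_cast
      ring
    calc ‖deriv Complex.digamma w - (∑ j ∈ Finset.range J, ((w + j) ^ 2)⁻¹ + 1 / (w + J) + 1 / (2 * (w + J) ^ 2) +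
          ∑ k ∈ Finset.Icc 1 ν, (bernoulli (2 * k) : ℂ) / (w + J) ^ (2 * k + 1))‖ * S
        ≤ (2 * ν + 2) * (Real.pi ^ 2 / 3 * ((2 * ν + 1).factorial : ℝ) / (2 * Real.pi) ^ (2 * ν + 1)) /
            (‖w + (J : ℂ)‖ ^ (2 * ν + 1) * (w.re + J)) * S := mul_le_mul_of_nonneg_right hrem hSr.le
      _ ≤ (2 * ν + 2) * ((10 / 3) * ((2 * ν + 1).factorial : ℝ)) / (6 : ℝ) ^ (2 * ν + 1) / r ^ (2 * ν + 2) * S :=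
          mul_le_mul_of_nonneg_right hR hSr.le
      _ = (S : ℝ) * ((2 * ν + 2) * ((10 / 3) * ((2 * ν + 1).factorial : ℝ)) / (6 : ℝ) ^ (2 * ν + 1) / r ^ (2 * ν + 2)) := by
          ring
      _ ≤ (stirlingRemDerivScaled S ν W.re.lo J : ℝ) := hceil
  · simp at h

end MC

end Literature.Analysis.ValidatedNumerics.NumericsMP
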